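import Summits.BirchSwinnertonDyer.BirchSwinnertonDyer.Theorems.SemiOrdinaryEisensteinDescentWildSplitEisensteinValueAtOneVNonsplitKummerUnramified
import Literature.NumberTheory.EllipticCurves.LocalFrobeniusGenerationProofs
import Literature.NumberTheory.EllipticCurves.GeomPointsGaloisModule
import Mathlib.FieldTheory.KrullTopology
import HarnessLib

/-!
# At a NON-SPLIT multiplicative place `v ∤ p` (`p` odd) unramified classes satisfy the local Kummer condition;
# Fisher 2016 Thm. 4.4 at `v ∤ p` in BOTH orientations, PROVED

Route `SemiOrdinaryEisensteinDescent` (SOED), crux of record E_𝟙^V `WildSplitEisensteinValueAtOneV`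
(stmt-BirchSwinnertonDyer-26610), width seat bsd-wall-soed-p1-w3 g22 (`--supports 26610 --as helper`). THEOREMS ONLY
(no definition, no named fact, standard axioms). Sequel to `…NonsplitKummerUnramified.lean` (p653117/p653862: at a non-split
multiplicative `v ∤ p`, `selmerLocalKer F K_v p ≤ unramifiedKer F[p] 𝔓`, "M"). Here the CONVERSE and the packaging:
* `unramifiedKer_primeBelow_le_selmerLocalKerOfEmb_of_nonsplit` / `unramifiedKer_le_selmerLocalKer_of_nonsplit` (**M′**):
  `unramifiedKer F[p] 𝔓 ≤ selmerLocalKer F K_v p` («`H¹(K_v^nr/K_v, F(K_v^nr))[p] = 0`»: `H¹(k_v, Φ) ≅ Φ/2Φ` for a non-split `I_n`);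
* `selmerLocalKer_eq_unramifiedKer_of_nonsplit`: EQUALITY (Gross's (7.1) shape at a non-split multiplicative place);
* `mem_selmerLocalKer_iff_h1Equiv_mem_of_nonsplit_good` = **Fisher 2016 Thm. 4.4 at `v ∤ p`**, both orientations: the named fact
  `Literature.NumberTheory.EllipticCurves.Fisher2016.thm44_selmerLocalKer_iff_of_nonsplit_good` with its ramification clause
  `v ∤ p ∨ e(v|p) < p − 1` replaced by the first disjunct (the case `v ∣ p` — Fisher's Lemma 4.3, formal groups — stays print);
  consumers of the fact at places `v ∤ p` can cite this theorem with the same binders minus `hF`.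

PROOF OF M′: multiplicative «Lang» by ROOTS OF UNITY on the twisted Tate uniformisation — see the docstring of
`unramifiedKer_primeBelow_le_selmerLocalKerOfEmb_of_nonsplit`; inputs (all PROVED in the tree): `exists_isArithFrobAt_localAbsIntegers`,
`eq_top_of_isOpen_of_frobenius_mem_of_inertia_le`, `exists_toAlgEquiv_ne_of_not_split`, `toAlgEquiv_eq_of_mem_inertia_of_sq_eq_gamma`,
`smul_eq_self_of_mem_inertia_of_pow_eq_one`, `frobenius_smul_eq_pow_of_pow_eq_one`, `krullTopology_mem_nhds_one_iff`.
BSD is not proved by any of this; nothing here is specific to the crux except its consumers (visibility rows, kind (iv)).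

## References
* [Fisher2016Visualizing7] T. Fisher, LMS J. Comput. Math. 19 (2016) Suppl. A, Thm. 4.4 (p. 106).
* [SilvermanATAEC1994] J. H. Silverman, *ATAEC*, GTM 151, Ch. V Lemma 5.2, Thm. 5.3, Cor. 5.4, Ex. 5.11.
* [MilneADT2006] J. S. Milne, *Arithmetic Duality Theorems*, I Prop. 3.8; [GrossLMS1991] §7 (7.1).
* [NeukirchANT1999] II (9.6); [SerreLocalFields1979] IV §4 Prop. 16, XIII §1.
-/

set_option autoImplicit false
-- the conventional namespace `Summit.BirchSwinnertonDyer.BirchSwinnertonDyer.Theorems.…` repeats the summit name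
set_option linter.dupNamespace false

noncomputable section

open scoped Classical NNReal Pointwise Topology

open NumberField IsDedekindDomain Field WeierstrassCurve
open Literature.NumberTheory.EllipticCurves Literature.NumberTheory.GaloisRepresentations
open IsDedekindDomain.HeightOneSpectrum

namespace Summit.BirchSwinnertonDyer.BirchSwinnertonDyer.Theorems.NonsplitKummerUnramified

variable {K : Type} [Field K] [NumberField K] (W : WeierstrassCurve K) [W.IsElliptic]
  {p : ℕ} [hp : Fact p.Prime] (v : HeightOneSpectrum (𝓞 K))

/-! ### §5 M′ at the prime cut out by an embedding -/

/-- **M′ (local form at one embedding).** `F = W` elliptic over a number field `K`, `p` odd, `v ∤ p` a place of NON-SPLIT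
multiplicative reduction, `ι : K̄ → K̄_v`, `𝔐` a prime of `\bar 𝓞_v` over `𝓂_v`: every class of `H¹(K, F[p])` unramified at
`𝔓_{ι,𝔐}` dies in `H¹(K_v, F)` along `ι`. Proof in the module docstring (local Frobenius, `ε = Fr γ/γ ∈ μ_p`, the root of unity
`δ` with `δ^{N+1} = ε⁻¹`, `b = Ψ((γδ)⁻¹)` with `Fr b − b = 2n₀`, density of `⟨Fr, I_𝔐⟩`).
[cite: SilvermanATAEC1994, Ch. V Lemma 5.2 (c), Thm. 5.3, Cor. 5.4, Ex. 5.11] [cite: MilneADT2006, I Prop. 3.8]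
[cite: Fisher2016Visualizing7, Thm. 4.4 (p. 106)] -/
theorem unramifiedKer_primeBelow_le_selmerLocalKerOfEmb_of_nonsplit (hp2 : p ≠ 2)
    (hv : (p : 𝓞 K) ∉ v.asIdeal) (hmult : W.HasMultiplicativeReductionAt v)
    (hns : ¬ W.HasSplitMultiplicativeReductionAt v)
    (ι : AlgebraicClosure K →ₐ[K] AlgebraicClosure (v.adicCompletion K))
    {𝔐 : Ideal v.localAbsIntegers} (h𝔐 : 𝔐 ∈ v.localPrimesAbove) :
    unramifiedKer (geomTorsion W (p : ℤ)) (v.primeBelow ι 𝔐) ≤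
      selmerLocalKerOfEmb W (v.adicCompletion K) ι (p : ℤ) := by
  intro c hc
  have hpp : p.Prime := hp.out
  haveI : NeZero p := ⟨hpp.ne_zero⟩
  haveI : CharZero (v.adicCompletion K) := charZero_of_injective_algebraMap (algebraMap K (v.adicCompletion K)).injective
  haveI : CharZero (AlgebraicClosure (v.adicCompletion K)) := charZero_of_injective_algebraMap
    (algebraMap (v.adicCompletion K) (AlgebraicClosure (v.adicCompletion K))).injective
  obtain ⟨k, hk⟩ : ∃ k : ℕ, p + 1 = 2 * k := by obtain ⟨j, hj⟩ := hpp.odd_of_ne_two hp2; exact ⟨j + 1, by omega⟩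
  obtain ⟨w, hw⟩ := v.exists_spectralValuation
  have hτ : ∀ (σ : absoluteGaloisGroup (v.adicCompletion K)) (y : AlgebraicClosure (v.adicCompletion K)),
      σ • y = absoluteGaloisGroup.toAlgEquiv (v.adicCompletion K) σ y := fun _ _ ↦ rfl
  -- a local arithmetic Frobenius; the inertia group is normal
  obtain ⟨Fr, hFr⟩ := exists_isArithFrobAt_localAbsIntegers v h𝔐
  haveI hInormal : (𝔐.inertia (absoluteGaloisGroup (v.adicCompletion K))).Normal :=
    inertia_normal_of_mem_localPrimesAbove v h𝔐
  -- the twisted Tate uniformisation at `v` (PROVED named fact)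
  obtain ⟨q, t, Ψ, hq0, hq1, -, ht2, hsurj, hker, hequiv, -⟩ :=
    TateCurve.Silverman1994_thmV53_corV54_tateUniformisation_holds W v hmult
  set qh : AlgebraicClosure (v.adicCompletion K) :=
    algebraMap (v.adicCompletion K) (AlgebraicClosure (v.adicCompletion K)) q with hqh
  have hqh0 : qh ≠ 0 := by
    rw [hqh]; exact (map_ne_zero_iff _ (algebraMap (v.adicCompletion K) (AlgebraicClosure (v.adicCompletion K))).injective).mpr hq0
  have hwq : w qh < 1 := by
    rw [← NNReal.coe_lt_coe, hqh, coe_spectralValuation_algebraMap hw, NNReal.coe_one]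
    exact Valued.toNormedField.norm_lt_one_iff.mpr hq1
  -- the inertia group fixes `t = √γ`; the Frobenius moves it (non-split)
  have hIt : ∀ σ ∈ 𝔐.inertia (absoluteGaloisGroup (v.adicCompletion K)),
      absoluteGaloisGroup.toAlgEquiv (v.adicCompletion K) σ t = t := fun σ hσ ↦
    TateCurve.toAlgEquiv_eq_of_mem_inertia_of_sq_eq_gamma W hmult h𝔐 ht2 hσ
  have hFrt : absoluteGaloisGroup.toAlgEquiv (v.adicCompletion K) Fr t ≠ t := by
    intro hfix
    obtain ⟨σ₀, hσ₀⟩ := TateCurve.exists_toAlgEquiv_ne_of_not_split W v hmult hns ht2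
    set St : Subgroup (absoluteGaloisGroup (v.adicCompletion K)) :=
      MulAction.stabilizer (absoluteGaloisGroup (v.adicCompletion K)) t with hSt
    have hopen : IsOpen (St : Set (absoluteGaloisGroup (v.adicCompletion K))) := by
      let L : IntermediateField (v.adicCompletion K) (AlgebraicClosure (v.adicCompletion K)) :=
        IntermediateField.adjoin (v.adicCompletion K) {t}
      haveI : FiniteDimensional (v.adicCompletion K) L :=
        IntermediateField.adjoin.finiteDimensional (Algebra.IsIntegral.isIntegral t)
      apply Subgroup.isOpen_mono (H₁ := L.fixingSubgroup) ?_ L.fixingSubgroup_isOpen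
      intro σ hσ
      exact (IntermediateField.mem_fixingSubgroup_iff _ _).mp hσ t (IntermediateField.mem_adjoin_simple_self _ t)
    have htop := eq_top_of_isOpen_of_frobenius_mem_of_inertia_le v h𝔐 hFr hopen hfix
      (fun σ hσ ↦ hIt σ hσ)
    have hmem : σ₀ ∈ St := by rw [htop]; exact Subgroup.mem_top σ₀
    exact hσ₀ hmem
  -- the cocycle and its pull-back `X` to `Γ_{K_v}` pushed into `F(K̄_v)`
  obtain ⟨φ, rfl⟩ :=
    oneCocycleClass_surjective (discreteTopRep (absoluteGaloisGroup K) (geomTorsion W (p : ℤ))) c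
  obtain ⟨a, ha⟩ := (oneCocycleClass_mem_subgroupResKer_iff _ φ).mp hc
  set X : absoluteGaloisGroup (v.adicCompletion K) → localPoints W (v.adicCompletion K) := fun σ ↦
    pointsMapOfEmb W ι ((φ.1 (resGalOfEmb ι σ) : geomTorsion W (p : ℤ)) : geomPoints W) with hX
  have hXmul : ∀ σ ρ : absoluteGaloisGroup (v.adicCompletion K), X (σ * ρ) = X σ + σ • X ρ := by
    intro σ ρ
    simp only [hX]
    rw [map_mul, φ.2, AddSubgroup.coe_add, map_add]
    change _ + pointsMapOfEmb W ι (((resGalOfEmb ι σ) • φ.1 (resGalOfEmb ι ρ) : geomTorsion W (p : ℤ)) :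
      geomPoints W) = _
    rw [Literature.NumberTheory.EllipticCurves.AddSubgroup.torsionBy.coe_smul, pointsMapOfEmb_smul]
  have hX1 : X 1 = 0 := by simp only [hX]; rw [map_one, contOneCocycles.apply_one, ZeroMemClass.coe_zero, map_zero]
  have hXp : ∀ σ : absoluteGaloisGroup (v.adicCompletion K), (p : ℤ) • X σ = 0 := fun σ ↦ by
    simp only [hX]
    rw [← map_zsmul, (mem_geomTorsion_iff W _ _).mp (φ.1 _).2, map_zero]
  set A : localPoints W (v.adicCompletion K) := pointsMapOfEmb W ι (a : geomPoints W) with hA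
  have hpA : (p : ℤ) • A = 0 := by rw [hA, ← map_zsmul, (mem_geomTorsion_iff W _ _).mp a.2, map_zero]
  have hXI : ∀ σ ∈ 𝔐.inertia (absoluteGaloisGroup (v.adicCompletion K)), X σ = σ • A - A := by
    intro σ hσ
    have h := ha ⟨resGalOfEmb ι σ, v.resGalOfEmb_mem_inertia_primeBelow ι 𝔐 hσ⟩
    simp only [hX]
    rw [h, AddSubgroupClass.coe_sub, map_sub,
      Literature.NumberTheory.EllipticCurves.AddSubgroup.torsionBy.coe_smul, pointsMapOfEmb_smul]
  -- `n₀ = X(Fr) - (Fr A - A)`: `p`-torsion and `I_𝔐`-invariant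
  set n₀ : localPoints W (v.adicCompletion K) := X Fr - (Fr • A - A) with hn₀
  have hpn₀ : (p : ℤ) • n₀ = 0 := by
    rw [hn₀, zsmul_sub, hXp, zsmul_sub, ← W.smul_zsmul_localPoints (p : ℤ) Fr A, hpA, smul_zero,
      sub_zero, sub_zero]
  have hIn₀ : ∀ σ ∈ 𝔐.inertia (absoluteGaloisGroup (v.adicCompletion K)), σ • n₀ = n₀ := by
    intro σ hσ
    have hconj : Fr⁻¹ * σ * Fr ∈ 𝔐.inertia (absoluteGaloisGroup (v.adicCompletion K)) := by
      have h := hInormal.conj_mem σ hσ Fr⁻¹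
      rwa [inv_inv] at h
    have h1 : X (σ * Fr) = (σ • A - A) + σ • X Fr := by rw [hXmul, hXI σ hσ]
    have h2 : X (σ * Fr) = X Fr + (σ • Fr • A - Fr • A) := by
      rw [show σ * Fr = Fr * (Fr⁻¹ * σ * Fr) by group, hXmul, hXI _ hconj, smul_sub, ← mul_smul,
        show Fr * (Fr⁻¹ * σ * Fr) = σ * Fr by group, mul_smul]
    have h3 : σ • X Fr = X Fr + (σ • Fr • A - Fr • A) - (σ • A - A) := by
      rw [← h2, h1]; abel
    rw [hn₀, smul_sub, smul_sub, h3]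
    abel
  -- `n₀ = Ψ(γ)` with `γ` fixed by `I_𝔐` and `γ^p ∈ q^ℤ`
  obtain ⟨γa, hγa⟩ := hsurj n₀
  set γu : (AlgebraicClosure (v.adicCompletion K))ˣ := Additive.toMul γa with hγu
  have hγ : Ψ (Additive.ofMul γu) = n₀ := by rw [hγu, ofMul_toMul]; exact hγa
  have hγ0 : (γu : AlgebraicClosure (v.adicCompletion K)) ≠ 0 := γu.ne_zero
  have hIγ : ∀ σ ∈ 𝔐.inertia (absoluteGaloisGroup (v.adicCompletion K)),
      σ • (γu : AlgebraicClosure (v.adicCompletion K)) = γu := by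
    intro σ hσ
    have h1 : Ψ (Additive.ofMul (Units.map (absoluteGaloisGroup.toAlgEquiv (v.adicCompletion K) σ :
        AlgebraicClosure (v.adicCompletion K) →* AlgebraicClosure (v.adicCompletion K)) γu)) =
        Ψ (Additive.ofMul γu) := by
      have h := hequiv σ γu
      rw [if_pos (hIt σ hσ), one_zsmul] at h
      rw [← h, hγ, hIn₀ σ hσ]
    have h2 : Ψ (Additive.ofMul (Units.map (absoluteGaloisGroup.toAlgEquiv (v.adicCompletion K) σ :
        AlgebraicClosure (v.adicCompletion K) →* AlgebraicClosure (v.adicCompletion K)) γu / γu)) = 0 := by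
      rw [ofMul_div, map_sub, h1, sub_self]
    obtain ⟨e, he⟩ := (hker _).mp h2
    have hw1 : w (qh ^ e) = 1 := by
      rw [← he, Units.val_div_eq_div_val, map_div₀, Units.coe_map, MonoidHom.coe_coe, ← hτ,
        spectralValuation_smul hw, div_self ((Valuation.ne_zero_iff w).mpr hγ0)]
    rw [map_zpow₀] at hw1
    have he0 : e = 0 := (zpow_eq_one_iff_right₀ zero_le hwq.ne).mp hw1
    have h3 : (Units.map (absoluteGaloisGroup.toAlgEquiv (v.adicCompletion K) σ :
        AlgebraicClosure (v.adicCompletion K) →* AlgebraicClosure (v.adicCompletion K)) γu / γu) = 1 :=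
      Units.ext (by rw [he, he0, zpow_zero, Units.val_one])
    have h4 := congrArg Units.val (div_eq_one.mp h3)
    rwa [Units.coe_map, MonoidHom.coe_coe] at h4
  have hγp : Ψ (Additive.ofMul (γu ^ p)) = 0 := by
    rw [ofMul_pow, map_nsmul, hγ, ← natCast_zsmul, hpn₀]
  obtain ⟨j, hj⟩ := (hker _).mp hγp
  -- `ε = Fr γ / γ ∈ μ_p`
  set ε : (AlgebraicClosure (v.adicCompletion K))ˣ := Units.map (absoluteGaloisGroup.toAlgEquiv
    (v.adicCompletion K) Fr : AlgebraicClosure (v.adicCompletion K) →* AlgebraicClosure (v.adicCompletion K)) γu / γu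
    with hε
  have hεp : ε ^ p = 1 := by
    rw [hε, div_pow, ← map_pow, div_eq_one]
    apply Units.ext
    rw [Units.coe_map, MonoidHom.coe_coe, hj, map_zpow₀, hqh, AlgEquiv.commutes]
  have hε0 : (ε : AlgebraicClosure (v.adicCompletion K)) ≠ 0 := ε.ne_zero
  -- the orders involved are prime to `v`
  set N : ℕ := Nat.card (IsLocalRing.ResidueField (v.adicCompletionIntegers K)) with hN
  have hwp : w (p : AlgebraicClosure (v.adicCompletion K)) = 1 := by
    have h := spectralValuation_intCast_eq_one hw (n := (p : ℤ)) (by rwa [Int.cast_natCast]); rwa [Int.cast_natCast] at h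
  have hwN1 : w ((N + 1 : ℕ) : AlgebraicClosure (v.adicCompletion K)) = 1 := by
    rw [Nat.cast_succ, add_comm, Valuation.map_one_add_of_lt]
    exact spectralValuation_natCast_residueCard_lt_one hw
  set m : ℕ := (N + 1) * p with hm
  have hm0 : m ≠ 0 := mul_ne_zero (Nat.succ_ne_zero N) hpp.ne_zero
  have hwm : w (m : AlgebraicClosure (v.adicCompletion K)) = 1 := by rw [hm, Nat.cast_mul, map_mul, hwN1, hwp, mul_one]
  -- `δ` with `δ^{N+1} = ε⁻¹`: a root of unity of order dividing `m`
  obtain ⟨δ, hδ⟩ := IsAlgClosed.exists_pow_nat_eq ((ε⁻¹ : (AlgebraicClosure (v.adicCompletion K))ˣ) :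
    AlgebraicClosure (v.adicCompletion K)) (Nat.succ_pos N)
  have hδ0 : δ ≠ 0 := by rintro rfl; rw [zero_pow (Nat.succ_ne_zero N)] at hδ; exact (ε⁻¹).ne_zero hδ.symm
  have hδm : δ ^ m = 1 := by
    rw [hm, pow_mul, hδ, Units.val_inv_eq_inv_val, inv_pow, ← Units.val_pow_eq_pow_val, hεp,
      Units.val_one, inv_one]
  have hIδ : ∀ σ ∈ 𝔐.inertia (absoluteGaloisGroup (v.adicCompletion K)), σ • δ = δ := fun σ hσ ↦
    smul_eq_self_of_mem_inertia_of_pow_eq_one hw h𝔐 hσ hm0 hwm hδm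
  have hFrδ : Fr • δ = δ ^ N := frobenius_smul_eq_pow_of_pow_eq_one hw h𝔐 hFr hm0 hwm hδm
  set δu : (AlgebraicClosure (v.adicCompletion K))ˣ := Units.mk0 δ hδ0 with hδu
  -- `b = Ψ((γδ)⁻¹)`, fixed by `I_𝔐`, with `Fr b - b = 2 n₀`
  set β : (AlgebraicClosure (v.adicCompletion K))ˣ := (γu * δu)⁻¹ with hβ
  set b : localPoints W (v.adicCompletion K) := Ψ (Additive.ofMul β) with hb
  have hIb : ∀ σ ∈ 𝔐.inertia (absoluteGaloisGroup (v.adicCompletion K)), σ • b = b := by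
    intro σ hσ
    have hσβ : Units.map (absoluteGaloisGroup.toAlgEquiv (v.adicCompletion K) σ :
        AlgebraicClosure (v.adicCompletion K) →* AlgebraicClosure (v.adicCompletion K)) β = β := by
      apply Units.ext
      rw [Units.coe_map, MonoidHom.coe_coe, hβ, Units.val_inv_eq_inv_val, Units.val_mul, hδu, Units.val_mk0,
        map_inv₀, map_mul, ← hτ, ← hτ, hIγ σ hσ, hIδ σ hσ]
    rw [hb, hequiv σ β, if_pos (hIt σ hσ), one_zsmul, hσβ]
  have hFrb : Fr • b - b = (2 : ℤ) • n₀ := by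
    have hprod : ((Units.map (absoluteGaloisGroup.toAlgEquiv (v.adicCompletion K) Fr :
        AlgebraicClosure (v.adicCompletion K) →* AlgebraicClosure (v.adicCompletion K)) β * β :
        (AlgebraicClosure (v.adicCompletion K))ˣ) : AlgebraicClosure (v.adicCompletion K)) =
        (((γu ^ 2)⁻¹ : (AlgebraicClosure (v.adicCompletion K))ˣ) : AlgebraicClosure (v.adicCompletion K)) := by
      have hFrγ : absoluteGaloisGroup.toAlgEquiv (v.adicCompletion K) Fr (γu : AlgebraicClosure (v.adicCompletion K)) =
          ε * γu := by
        rw [hε, Units.val_div_eq_div_val, Units.coe_map, MonoidHom.coe_coe, div_mul_cancel₀ _ hγ0]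
      have hFrδ' : absoluteGaloisGroup.toAlgEquiv (v.adicCompletion K) Fr δ = δ ^ N := by rw [← hτ]; exact hFrδ
      rw [Units.val_mul, Units.coe_map, MonoidHom.coe_coe, hβ, Units.val_inv_eq_inv_val, Units.val_mul, hδu,
        Units.val_mk0, map_inv₀, map_mul, hFrγ, hFrδ', Units.val_inv_eq_inv_val, Units.val_pow_eq_pow_val,
        ← mul_inv, inv_inj]
      calc (ε : AlgebraicClosure (v.adicCompletion K)) * γu * δ ^ N * (γu * δ)
          = (γu : AlgebraicClosure (v.adicCompletion K)) ^ 2 *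
              ((ε : AlgebraicClosure (v.adicCompletion K)) * δ ^ (N + 1)) := by ring
        _ = (γu : AlgebraicClosure (v.adicCompletion K)) ^ 2 := by
          rw [hδ, Units.val_inv_eq_inv_val, mul_inv_cancel₀ hε0, mul_one]
    have hprod' : Units.map (absoluteGaloisGroup.toAlgEquiv (v.adicCompletion K) Fr :
        AlgebraicClosure (v.adicCompletion K) →* AlgebraicClosure (v.adicCompletion K)) β * β = (γu ^ 2)⁻¹ :=
      Units.ext hprod
    rw [hb, hequiv Fr β, if_neg hFrt, neg_one_zsmul, ← neg_add', ← map_add, ← ofMul_mul,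
      hprod', ofMul_inv, map_neg, neg_neg, ofMul_pow, map_nsmul, hγ, ← natCast_zsmul, Nat.cast_ofNat]
  -- the zero locus of `2X - ∂(2A + b)` is an open subgroup containing `I_𝔐` and `Fr`
  set C : localPoints W (v.adicCompletion K) := (2 : ℤ) • A + b with hC
  set h₂ : absoluteGaloisGroup (v.adicCompletion K) → localPoints W (v.adicCompletion K) :=
    fun σ ↦ (2 : ℤ) • X σ - (σ • C - C) with hh₂
  have hh₂mul : ∀ σ ρ : absoluteGaloisGroup (v.adicCompletion K), h₂ (σ * ρ) = h₂ σ + σ • h₂ ρ := by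
    intro σ ρ
    simp only [hh₂]
    rw [hXmul, mul_smul, smul_sub, smul_sub, zsmul_add, W.smul_zsmul_localPoints (2 : ℤ) σ (X ρ)]
    abel
  have hh₂one : h₂ 1 = 0 := by simp only [hh₂]; rw [hX1, one_smul, sub_self, zsmul_zero, sub_self]
  set Z : Subgroup (absoluteGaloisGroup (v.adicCompletion K)) :=
    { carrier := {σ | h₂ σ = 0}
      one_mem' := hh₂one
      mul_mem' := fun {σ ρ} hσ hρ ↦ by
        change h₂ (σ * ρ) = 0
        change h₂ σ = 0 at hσ
        change h₂ ρ = 0 at hρ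
        rw [hh₂mul, hσ, hρ, smul_zero, add_zero]
      inv_mem' := fun {σ} hσ ↦ by
        change h₂ σ⁻¹ = 0
        change h₂ σ = 0 at hσ
        have h := hh₂mul σ⁻¹ σ
        rw [inv_mul_cancel, hh₂one, hσ, smul_zero, add_zero] at h
        exact h.symm } with hZ
  have hmemZ : ∀ σ : absoluteGaloisGroup (v.adicCompletion K), σ ∈ Z ↔ h₂ σ = 0 := fun σ ↦ Iff.rfl
  -- openness: `Z ⊇ res⁻¹(Gal(K̄/E)) ⊓ Stab(C)` with `φ|_{Gal(K̄/E)} = 0`, `E/K` finite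
  have hZopen : IsOpen (Z : Set (absoluteGaloisGroup (v.adicCompletion K))) := by
    have hnhds : {τ : absoluteGaloisGroup K | φ.1 τ = 0} ∈ 𝓝 (1 : absoluteGaloisGroup K) := by
      refine ((isOpen_discrete ({0} : Set (geomTorsion W (p : ℤ)))).preimage φ.1.continuous).mem_nhds ?_
      change φ.1 1 ∈ ({0} : Set (geomTorsion W (p : ℤ)))
      rw [contOneCocycles.apply_one]
      exact Set.mem_singleton 0
    obtain ⟨E, hEfin, hE⟩ := (krullTopology_mem_nhds_one_iff K (AlgebraicClosure K) _).mp hnhds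
    haveI := hEfin
    set V : Subgroup (absoluteGaloisGroup (v.adicCompletion K)) :=
      (E.fixingSubgroup.comap ((resGalOfEmb ι : absoluteGaloisGroup (v.adicCompletion K) →ₜ*
        absoluteGaloisGroup K) : absoluteGaloisGroup (v.adicCompletion K) →* absoluteGaloisGroup K)) ⊓
      MulAction.stabilizer (absoluteGaloisGroup (v.adicCompletion K)) C with hV
    have hVopen : IsOpen (V : Set (absoluteGaloisGroup (v.adicCompletion K))) := by
      rw [hV, Subgroup.coe_inf, Subgroup.coe_comap]
      exact (E.fixingSubgroup_isOpen.preimage (resGalOfEmb ι).continuous).inter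
        (W.isOpen_stabilizer_localPoints (v.adicCompletion K) C)
    refine Subgroup.isOpen_mono (H₁ := V) (fun σ hσ ↦ ?_) hVopen
    rw [hV, Subgroup.mem_inf, Subgroup.mem_comap] at hσ
    obtain ⟨hσE, hσC⟩ := hσ
    have h0 : φ.1 (resGalOfEmb ι σ) = 0 := hE hσE
    have hX0 : X σ = 0 := by simp only [hX]; rw [h0, ZeroMemClass.coe_zero, map_zero]
    rw [hmemZ]
    simp only [hh₂]
    rw [hX0, zsmul_zero, MulAction.mem_stabilizer_iff.mp hσC, sub_self, sub_self]
  -- `Fr ∈ Z` and `I_𝔐 ≤ Z`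
  have hFrZ : Fr ∈ Z := by
    rw [hmemZ]
    simp only [hh₂]
    rw [hC, smul_add, W.smul_zsmul_localPoints (2 : ℤ) Fr A,
      show (2 : ℤ) • X Fr = (2 : ℤ) • n₀ + (2 : ℤ) • (Fr • A - A) by rw [hn₀, ← zsmul_add, sub_add_cancel],
      ← hFrb, zsmul_sub]
    abel
  have hIZ : 𝔐.inertia (absoluteGaloisGroup (v.adicCompletion K)) ≤ Z := by
    intro σ hσ
    rw [hmemZ]
    simp only [hh₂]
    rw [hXI σ hσ, hC, smul_add, hIb σ hσ, W.smul_zsmul_localPoints (2 : ℤ) σ A, zsmul_sub]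
    abel
  have hZtop := eq_top_of_isOpen_of_frobenius_mem_of_inertia_le v h𝔐 hFr hZopen hFrZ hIZ
  have hall : ∀ σ : absoluteGaloisGroup (v.adicCompletion K), (2 : ℤ) • X σ = σ • C - C := by
    intro σ
    have h : σ ∈ Z := by rw [hZtop]; exact Subgroup.mem_top σ
    rw [hmemZ] at h
    simp only [hh₂] at h
    exact sub_eq_zero.mp h
  -- conclusion: `X = ∂(k • C)` since `p X = 0` and `p + 1 = 2k`
  unfold selmerLocalKerOfEmb
  rw [mem_resKer_iff, map_oneCocycleClass, oneCocycleClass_eq_zero_iff]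
  refine ⟨(k : ℤ) • C, fun σ ↦ ?_⟩
  rw [contOneCocycles.pullback_apply]
  change X σ = σ • ((k : ℤ) • C) - (k : ℤ) • C
  have hk' : X σ = (k : ℤ) • ((2 : ℤ) • X σ) := by
    rw [← mul_zsmul, show (k : ℤ) * 2 = (p : ℤ) + 1 by omega, add_zsmul, one_zsmul, hXp,
      zero_add]
  rw [hk', hall σ, W.smul_zsmul_localPoints (k : ℤ) σ C, zsmul_sub]

/-! ### §6 M′ at every prime above `v`; the equality; Fisher 2016 Thm. 4.4 at `v ∤ p` -/

/-- **M′. Unramified classes satisfy the local Kummer condition at a non-split multiplicative place `v ∤ p`, `p` odd**: for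
`F = W` elliptic over a number field `K` with NON-SPLIT multiplicative reduction at `v`, `(p) ⊄ v`, and every prime `𝔓` of
`\bar ℤ_K` above `v`, `unramifiedKer F[p] 𝔓 ≤ selmerLocalKer F K_v p` («`H¹(K_v^nr/K_v, F(K_v^nr))[p] = 0`», Milne *ADT* I 3.8
at a place with `p ∤ c_v`). Reduction to the embedding form as in `unramifiedKer_le_selmerLocalKer`.
[cite: MilneADT2006, I Prop. 3.8] [cite: SilvermanATAEC1994, Ch. V Thm. 5.3, Cor. 5.4] [cite: Fisher2016Visualizing7, Thm. 4.4 (p. 106)] -/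
theorem unramifiedKer_le_selmerLocalKer_of_nonsplit (hp2 : p ≠ 2)
    (hv : (p : 𝓞 K) ∉ v.asIdeal) (hmult : W.HasMultiplicativeReductionAt v)
    (hns : ¬ W.HasSplitMultiplicativeReductionAt v)
    {𝔓 : Ideal (absIntegers (𝓞 K) K)} (h𝔓 : 𝔓 ∈ v.primesAbove) :
    unramifiedKer (geomTorsion W (p : ℤ)) 𝔓 ≤ selmerLocalKer W (v.adicCompletion K) (p : ℤ) := by
  obtain ⟨𝔐, h𝔐⟩ := v.localPrimesAbove_nonempty
  obtain ⟨g, hg⟩ := HeightOneSpectrum.exists_smul_eq_of_mem_primesAbove_holds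
    (HeightOneSpectrum.primeBelow_mem_primesAbove
      (ι := closureEmb (K := K) (v.adicCompletion K)) h𝔐) h𝔓
  have h1 : 𝔓 = v.primeBelow ((closureEmb (K := K) (v.adicCompletion K)).comp
      ((show AlgebraicClosure K ≃ₐ[K] AlgebraicClosure K from g⁻¹) :
        AlgebraicClosure K →ₐ[K] AlgebraicClosure K)) 𝔐 := by
    rw [HeightOneSpectrum.primeBelow_comp, ← hg]
    exact congrArg (· • _) (inv_inv g).symm
  rw [h1, ← selmerLocalKer_eq_of_algHom_holds W (v.adicCompletion K) _ (p : ℤ)]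
  exact unramifiedKer_primeBelow_le_selmerLocalKerOfEmb_of_nonsplit W v hp2 hv hmult hns _ h𝔐

/-- **Gross's (7.1) shape at a NON-SPLIT multiplicative place `v ∤ p` (`p` odd): the local Selmer condition IS "unramified at
`v`"** — `selmerLocalKer F K_v p = unramifiedKer F[p] 𝔓` for every `𝔓 ∣ v` (M of `…NonsplitKummerUnramified.lean` and M′).
[cite: GrossLMS1991, §7 (7.1)] [cite: MilneADT2006, I Prop. 3.8] [cite: Fisher2016Visualizing7, Thm. 4.4 (p. 106)] -/
theorem selmerLocalKer_eq_unramifiedKer_of_nonsplit (hp2 : p ≠ 2)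
    (hv : (p : 𝓞 K) ∉ v.asIdeal) (hmult : W.HasMultiplicativeReductionAt v)
    (hns : ¬ W.HasSplitMultiplicativeReductionAt v)
    {𝔓 : Ideal (absIntegers (𝓞 K) K)} (h𝔓 : 𝔓 ∈ v.primesAbove) :
    selmerLocalKer W (v.adicCompletion K) (p : ℤ) = unramifiedKer (geomTorsion W (p : ℤ)) 𝔓 :=
  le_antisymm (selmerLocalKer_le_unramifiedKer_of_nonsplit W v hp2 hv hmult hns h𝔓)
    (unramifiedKer_le_selmerLocalKer_of_nonsplit W v hp2 hv hmult hns h𝔓)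

/-- **Fisher 2016, Thm. 4.4 at a place `v ∤ p` (`p` odd), BOTH orientations, PROVED.** For elliptic curves `E = W`, `E′ = W′`
over a number field `K`, a `Γ_K`-isomorphism `θ : E′[p] ⥲ E[p]`, and a finite place `v ∤ p` at which (`E` is non-split
multiplicative and `E′` good) or (`E` is good and `E′` non-split multiplicative): `c ∈ 𝓢_v(E′) ↔ θ_* c ∈ 𝓢_v(E)`. Both local
conditions are "unramified at `𝔓 ∣ v`" (`selmerLocalKer_eq_unramifiedKer` at the good curve, `selmerLocalKer_eq_unramifiedKer_of_nonsplit`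
at the non-split one) and unramifiedness passes through `θ` (`mem_unramifiedKer_iff_h1Equiv_mem`).
[cite: Fisher2016Visualizing7, Thm. 4.4 (p. 106)] [cite: GrossLMS1991, §7 (7.1)] -/
theorem mem_selmerLocalKer_iff_h1Equiv_mem_of_nonsplit_good (hp2 : p ≠ 2)
    (W' : WeierstrassCurve K) [W'.IsElliptic]
    (θ : geomTorsion W' (p : ℤ) ≃+ geomTorsion W (p : ℤ))
    (hθ : ∀ (σ : absoluteGaloisGroup K) (P : geomTorsion W' (p : ℤ)), θ (σ • P) = σ • θ P)
    (hv : (p : 𝓞 K) ∉ v.asIdeal)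
    (hkind : (W.HasMultiplicativeReductionAt v ∧ ¬ W.HasSplitMultiplicativeReductionAt v ∧
        W'.HasGoodReductionAt v) ∨
      (W.HasGoodReductionAt v ∧ W'.HasMultiplicativeReductionAt v ∧
        ¬ W'.HasSplitMultiplicativeReductionAt v))
    (c : galH1Torsion W' (p : ℤ)) :
    c ∈ selmerLocalKer W' (v.adicCompletion K) (p : ℤ) ↔
      h1Equiv θ hθ c ∈ selmerLocalKer W (v.adicCompletion K) (p : ℤ) := by
  obtain ⟨𝔓, h𝔓⟩ := v.primesAbove_nonempty
  have hn : ((p : ℤ) : 𝓞 K) ∉ v.asIdeal := by rwa [Int.cast_natCast]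
  rcases hkind with ⟨hWm, hWns, hW'g⟩ | ⟨hWg, hW'm, hW'ns⟩
  · rw [W'.selmerLocalKer_eq_unramifiedKer hW'g hn h𝔓, selmerLocalKer_eq_unramifiedKer_of_nonsplit W v hp2 hv hWm hWns h𝔓]
    exact mem_unramifiedKer_iff_h1Equiv_mem W W' θ hθ 𝔓 c
  · rw [W.selmerLocalKer_eq_unramifiedKer hWg hn h𝔓, selmerLocalKer_eq_unramifiedKer_of_nonsplit W' v hp2 hv hW'm hW'ns h𝔓]
    exact mem_unramifiedKer_iff_h1Equiv_mem W W' θ hθ 𝔓 c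

end Summit.BirchSwinnertonDyer.BirchSwinnertonDyer.Theorems.NonsplitKummerUnramified

end
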